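import Summits.QuantumFields.BalabanUV.Beta.D1BFx.PackedRoadRowsPow

/-!
# `BalabanUV.Beta.D1BFx.PackedRoadRowsMass` — road «BF-x» for binder row D1, slot (K): **«ROAD ROWS ON THE SUBSEQUENCE FROM MASS LETTERS» —
# THE FAÇADE `PackedRoadRowsPow` WITH THE LITERAL's (L1)(L2) INPUTS IN THE SAME CURRENCY AS (C1)(C2): n-UNIFORM BLOCK-MASS LETTERS OF THE
# LITERAL's OWN STENCIL FAMILIES ON THE SCALES `n = Lc^k`, INSTEAD OF «SOCKET ENVELOPE + FLOOR + UNITS INEQUALITY»**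

HONEST DEPENDENCY (cell records, verbatim): «continuum YM on T⁴ ⇐ BetaPertH ∧ nine spine estimates (0/9 proved); BetaPertH ⇐ (D1) ∧ (D4) ∧
CAP+tail; G-an2-4 gates asym, D1 and NE2/3/4.»  HONEST FRAMING (cell contract, verbatim): «discharging `BetaPertH` makes Bałaban's UV stability
UNCONDITIONAL — a real constructive-QFT result; it is NOT the continuum limit and NOT the Clay problem.»  THIS MODULE DISCHARGES NOTHING of the
wall: [folklore] plumbing — gan24-leaf-05's packed-column mass calculus (`PackedColumnJetMass.mass_blk_vertexOfK_G₀_le` via `PackedRoadJetRows.road_jet_mass_le`,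
`PackedColumnTableMass.mass_blk_vertex2OfK_G₀_le_blockRate`), leaf-03's readers (`PackedLettersAtSites.vertex2OfK_eq_sliceSum`, `PackedCoframeMassRoad.blk_W2NInf_*`
through `PackedRoadTableRows.abs_blk_W2NInf_le`) and this lineage's slot packs (`RestKernelSlotRowsOn.exists_END_rows_Rk{Sand,Blk}_pow`) BY NAME.  The INPUT
letters are HYPOTHESES displayed ON THE SCALES: (L1-M) the `u`-centred `σS∕n`-weighted block masses of the literal's first stencils `S (Lc^k) κ u`
(`≤ mS j k′`, k-free), (L2-M) the plain block masses of the literal's pair stencils `S₂ (Lc^k) κ u κ′ u′` with pair-separation decay at the block-scale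
rate (`≤ mB j i·e^{−(δ₀∕n)|u′−u|₁}`, k-free), and the road's two co-frame letters (C1)(C2) exactly as in `PackedRoadRowsPow`; modulo [B5] `h12`∕`h126` BY NAME.
No definition, no `def … : Prop`, no notation, nothing cited, 0 sorry.  0 root-level binders of row D1 discharged (hW ∕ hR-sockets ∕ hSX-socket ∕ D1Tel ∕
D1Rep — 0); (K) NOT closed; NOT D1, NOT `BetaPertH`, NOT continuum, NOT Clay.

ABSOLUTE RULE (cell charter, verbatim): «No internally-minted statement may enter as a cited fact. Every hypothesis is either kernel-proved in
this package or a verbatim quotation of a PUBLISHED theorem with page reference. The manuscript(s) under audit are NOT citable for their own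
disputed steps — they are the thing under adjudication; programme-internal (2001/route/tribunal) claims are never citable.»

WHY (unit `b2b-balaban-beta-d1-formalise-leaf-01`, gen 25; located rationale R-leaf01-g25-1, journal).  `PackedRoadRowsPow` (gen 24) reads (L1)(L2) through the
ENVELOPE of the literal's sockets (`LocStencil (S n) (Cs n) (δS n)` + floor `δS₀∕n ≤ δS n` + units `16·Cs n·Zl 4 (δS n∕2)² ≤ uS`; `BiLoc` body + floor + units for the
pairs).  At a block-scale rate `δS n ≍ 1∕n` the envelope factor `Zl 4 (δS n∕2)²` grows like `n⁸` (a kernel spread over a block but banded in `x − y` has mass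
`≍ sup·n⁴`, envelope cost `≍ sup·n⁸`), and road FP's composite data (`FP/CompositeStencilTables.locStencil_SfoldComp ∕ vertexFamily₂_WtComp`) supply only
`∃ C δ′` PER STEP.  gan24-leaf-05's packed-column lemmas downstream take MASSES, not envelopes; so this file displays (L1)(L2) as n-uniform MASS letters —
weaker than the gen-24 display (`RestKernelSandwichLoc.mass_blk_le_of_locStencil ∕ _of_body`), in the currency of (C1)(C2).  The per-scale pair socket `hS₂`
(ANY constants, no uniformity) is still consumed, for leaf-03's slice-sum identity `W2litInf = vertex2OfK G₀ S₂` only.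

CONTENT (all [folklore]).  §1 `mass_rate_mono`; **`road_table_mass_at_of_mass (N) [NeZero N]`** = gen 24's `road_table_mass_le ∕ _at` with the pair letter
DISPLAYED as a plain mass with separation decay `mB j i·e^{−(δ₀∕N)|u′−u|₁}`.  §2 **`jet_letters_mass`** ((L1-M) + (C1) ⟹ the jets' letters at `Vroad a r S (Lc^k)`,
any `0 ≤ σV ≤ min (κ′∕16) σS`), **`table_letters_mass`** ((L2-M) + (C2) ⟹ the tables' letters at `Wroad a r S₂ (Lc^k) μ 0 ν z`).  §3 **`road_blk_rows_mass`**,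
**`road_sand_rows_mass`** — PART 13∕14∕15's (i) `hMR` ∕ (ii) READING (b) `hRu` rows on `n = Lc^k`, `k ≥ 1`; binder lists = `road_*_rows_pow`'s with
`{Cs δS} hS hCs hδS hσVS huS` ↦ `{σS mS} hSs hSm hσVσ` and `hδ₀₂ huT` ↦ `{mB} hBs hBm`.
NOT HERE (honest): the letters themselves (the literal's suppliers ∕ (J1)); the comb-FP ∕ ghost lanes; the END (the OWNER's); `TshotOf`.
Unit `b2b-balaban-beta-d1-formalise-leaf-01` (gen 25), D1 formalisation swarm leaf prover 01, road «BF-x»; INTENT «ROAD ROWS FROM MASS LETTERS» (journal).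
-/

noncomputable section

open Finset
open scoped BigOperators
open Literature.MathematicalPhysics.QuantumFieldTheory.Balaban1983to89
open Literature.MathematicalPhysics.QuantumFieldTheory.Balaban1983to89.Beta
open B12Sec2to5 (l1 l1_nonneg)
open B5Hk163Strip (kappa163 kappa163_pos)
open B5Hk163Decay (MG163)
open B4TorusKernel (periodConst)
open DecimatedMomentSummable (AbsMoment₂)
open ExpKernelCalculus (Site MKer BiLoc Zl)
open OneStepResolventKernel (Fib)
open OneStepKernelFamily (KInvStep colH)
open SecondOrderResponse (vertex2OfK)
open AffineAveraging (box toSite)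
open VectorTailsLoc (fam kfam)
open Summit.QuantumFields.BalabanUV.Beta.AxialDressingRooted (coDressKBmAt decays_coDressKBmAt_KInvStep)
open Summit.QuantumFields.BalabanUV.Beta.D1BFx.PackedKernelSplit (blk)
open Summit.QuantumFields.BalabanUV.Beta.D1BFx.PackedSortedBridges (embFF)
open Summit.QuantumFields.BalabanUV.Beta.D1BFx.FrozenLegTails (nOf MOf hn1)
open Summit.QuantumFields.BalabanUV.Beta.D1BFx.TorusWeightWordTwisted (tBw₁)
open Summit.QuantumFields.BalabanUV.Beta.D1BFx.PackedCoframePairLimit (cofPairInf)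
open Summit.QuantumFields.BalabanUV.Beta.D1BFx.PackedLettersAtSites (vertex2OfK_eq_sliceSum)
open Summit.QuantumFields.BalabanUV.Beta.D1BFx.PackedColumnEnvelope (colH_G₀_road_weight_nonneg)
open Summit.QuantumFields.BalabanUV.Beta.D1BFx.PackedColumnTableMass (mass_blk_vertex2OfK_G₀_le_blockRate)
open Summit.QuantumFields.BalabanUV.Beta.D1BFx.PackedNSidePair (W2litInf W2NInf)
open Summit.QuantumFields.BalabanUV.Beta.D1BFx.GhostStencil (l1_zero)
open Summit.QuantumFields.BalabanUV.Beta.D1BFx.RestKernelSandwichSlot (RkSand CUsand)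
open Summit.QuantumFields.BalabanUV.Beta.D1BFx.RestKernelBlockSlot (RkBlk CUblk)
open Summit.QuantumFields.BalabanUV.Beta.D1BFx.RestKernelSlotRowsOn (exists_END_rows_RkSand_pow exists_END_rows_RkBlk_pow)
open Summit.QuantumFields.BalabanUV.Beta.D1BFx.PackedRoadTableRows (abs_blk_W2NInf_le Zl_blockRate_le road_tableRate_pos)
open Summit.QuantumFields.BalabanUV.Beta.D1BFx.PackedRoadRestFamily (Vroad Wroad)
open Summit.QuantumFields.BalabanUV.Beta.D1BFx.PackedRoadRowsPow (rate_window Vroad_of_neZero Wroad_of_neZero road_jet_mass_at)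

namespace Summit.QuantumFields.BalabanUV.Beta.D1BFx.PackedRoadRowsMass

/-! ## §1 A rate tool; one scale in mass currency -/

/-- [folklore] **A CENTRED WEIGHTED MASS LETTER SURVIVES A SMALLER RATE**: for `0 ≤ σ′ ≤ σ`, if `Σ'_p Σ_{g f} |K p.1 p.2 g f|·e^{σ(|p.1−u|₁+|p.2−u|₁)}`
is summable and `≤ m`, so is the same letter at `σ′` (term by term `e^{σ′w} ≤ e^{σw}`, `w ≥ 0`). -/
theorem mass_rate_mono {F : Type*} [Fintype F] {K : MKer 4 F} {u : Site 4} {σ σ' m : ℝ} (hle : σ' ≤ σ)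
    (hs : Summable fun p : Site 4 × Site 4 => ∑ g, ∑ f, |K p.1 p.2 g f| * Real.exp (σ * (l1 (p.1 - u) + l1 (p.2 - u))))
    (hm : ∑' p : Site 4 × Site 4, ∑ g, ∑ f, |K p.1 p.2 g f| * Real.exp (σ * (l1 (p.1 - u) + l1 (p.2 - u))) ≤ m) :
    (Summable fun p : Site 4 × Site 4 => ∑ g, ∑ f, |K p.1 p.2 g f| * Real.exp (σ' * (l1 (p.1 - u) + l1 (p.2 - u)))) ∧
      ∑' p : Site 4 × Site 4, ∑ g, ∑ f, |K p.1 p.2 g f| * Real.exp (σ' * (l1 (p.1 - u) + l1 (p.2 - u))) ≤ m := by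
  have hw : ∀ p : Site 4 × Site 4, 0 ≤ l1 (p.1 - u) + l1 (p.2 - u) := fun p => add_nonneg (l1_nonneg _) (l1_nonneg _)
  have hle' : ∀ p : Site 4 × Site 4, ∑ g, ∑ f, |K p.1 p.2 g f| * Real.exp (σ' * (l1 (p.1 - u) + l1 (p.2 - u)))
      ≤ ∑ g, ∑ f, |K p.1 p.2 g f| * Real.exp (σ * (l1 (p.1 - u) + l1 (p.2 - u))) := fun p =>
    Finset.sum_le_sum fun g _ => Finset.sum_le_sum fun f _ =>
      mul_le_mul_of_nonneg_left (Real.exp_le_exp.mpr (mul_le_mul_of_nonneg_right hle (hw p))) (abs_nonneg _)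
  have h0 : ∀ p : Site 4 × Site 4, 0 ≤ ∑ g, ∑ f, |K p.1 p.2 g f| * Real.exp (σ' * (l1 (p.1 - u) + l1 (p.2 - u))) := fun p =>
    Finset.sum_nonneg fun g _ => Finset.sum_nonneg fun f _ => by positivity
  have hs' : Summable fun p : Site 4 × Site 4 => ∑ g, ∑ f, |K p.1 p.2 g f| * Real.exp (σ' * (l1 (p.1 - u) + l1 (p.2 - u))) :=
    Summable.of_nonneg_of_le h0 hle' hs
  exact ⟨hs', (Summable.tsum_le_tsum hle' hs' hs).trans hm⟩

/-- [folklore] **ONE SCALE, MASS CURRENCY (any block size `[NeZero N]`).**  For an in-block root `r`, a pair-stencil family `S₂` with the literal's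
per-scale socket `BiLoc (S₂ κ u κ′ u′) u u (Ck·e^{−δ₂|u′−u|₁}) δ₂` (`0 ≤ Ck`, `0 < δ₂`; used ONLY for leaf-03's slice-sum identity `W2litInf = vertex2OfK G₀ S₂`),
the pair MASS letter `Σ'|blk (S₂ κ u κ′ u′) j i| ≤ mB j i·e^{−(δ₀∕N)|u′−u|₁}` (summable; `0 < δ₀`) and the co-frame table letter at the base bond `(μ, 0)`, every
block of `W2NInf (N−1) a r S₂ μ 0 ν z` has summable plain mass `≤ (16·C_{G₀}²·(1+16∕κ′)⁴·(1+4∕δ₀)⁴·mB j i + mC j i)·e^{−min (κ′∕8) (min (δ₀∕2) κc)·|z|₁}`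
(gen 24's `PackedRoadTableRows.road_table_mass_le` with the pair letter DISPLAYED instead of «floor + units», re-indexed on `N`). -/
theorem road_table_mass_at_of_mass (N : ℕ) [NeZero N] {a : ℝ} {r : Fin (3 + 1) → ℕ} (hr : r ∈ box (3 + 1) N)
    {S₂ : Fin 4 → (Fin 4 → ℤ) → Fin 4 → (Fin 4 → ℤ) → MKer 4 (Fib 3)} {Ck δ₂ : ℝ}
    (hS₂ : ∀ κ u κ' u', BiLoc (S₂ κ u κ' u') u u (Ck * Real.exp (-δ₂ * l1 (u' - u))) δ₂) (hCk : 0 ≤ Ck) (hδ₂ : 0 < δ₂)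
    {δ₀ : ℝ} (hδ₀ : 0 < δ₀) {mB : Bool → Bool → ℝ}
    (hBs : ∀ κ u κ' u' j i, Summable fun p : Site 4 × Site 4 => ∑ g, ∑ f, |blk (S₂ κ u κ' u') j i p.1 p.2 g f|)
    (hBm : ∀ κ u κ' u' j i, ∑' p : Site 4 × Site 4, ∑ g, ∑ f, |blk (S₂ κ u κ' u') j i p.1 p.2 g f|
      ≤ mB j i * Real.exp (-(δ₀ / ((N : ℕ) : ℝ)) * l1 (u' - u)))
    {μ ν : Fin 4} {mC : Bool → Bool → ℝ} {κc : ℝ}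
    (hCs : ∀ (z : Site 4) (j i : Bool), Summable fun q : Site 4 × Site 4 => ∑ g, ∑ f,
      |blk (embFF (cofPairInf N a (colH (coDressKBmAt (toSite r) N (KInvStep (d := 3) N 0)) N μ 0)
        (colH (coDressKBmAt (toSite r) N (KInvStep (d := 3) N 0)) N ν z))) j i q.1 q.2 g f|)
    (hCm : ∀ (z : Site 4) (j i : Bool), ∑' q : Site 4 × Site 4, ∑ g, ∑ f,
      |blk (embFF (cofPairInf N a (colH (coDressKBmAt (toSite r) N (KInvStep (d := 3) N 0)) N μ 0)
        (colH (coDressKBmAt (toSite r) N (KInvStep (d := 3) N 0)) N ν z))) j i q.1 q.2 g f| ≤ mC j i * Real.exp (-κc * l1 z))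
    (z : Site 4) (j i : Bool) :
    (Summable fun q : Site 4 × Site 4 => ∑ g, ∑ f, |blk (W2NInf (N - 1) a r S₂ μ 0 ν z) j i q.1 q.2 g f|) ∧
      ∑' q : Site 4 × Site 4, ∑ g, ∑ f, |blk (W2NInf (N - 1) a r S₂ μ 0 ν z) j i q.1 q.2 g f|
        ≤ (16 * ((MG163 4 * periodConst (kappa163 4) 3) * (1 + 8 * (1 + Real.exp (kappa163 4 / 4))) * Real.exp (kappa163 4 / 4)) ^ 2
              * (1 + 16 / (kappa163 4 / 4)) ^ 4 * (1 + 4 / δ₀) ^ 4 * mB j i + mC j i)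
          * Real.exp (-(min (kappa163 4 / 4 / 8) (min (δ₀ / 2) κc)) * l1 z) := by
  obtain ⟨m, rfl⟩ : ∃ m, N = m + 1 := ⟨N - 1, (Nat.succ_pred_eq_of_ne_zero (NeZero.ne N)).symm⟩
  have hn0 : (0 : ℝ) < ((m + 1 : ℕ) : ℝ) := by exact_mod_cast Nat.succ_pos m
  have hκ : 0 < kappa163 4 := kappa163_pos 4
  set K₀ : ℝ := (MG163 4 * periodConst (kappa163 4) 3) * (1 + 8 * (1 + Real.exp (kappa163 4 / 4))) * Real.exp (kappa163 4 / 4) with hK₀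
  set ρ : ℝ := min (kappa163 4 / 4 / 8) (min (δ₀ / 2) κc) with hρ
  -- the literal table IS `vertex2OfK G₀ n S₂` (leaf-03's slice-sum identity, under the per-scale socket)
  obtain ⟨δG, CG, hδG, hCG, hG⟩ := decays_coDressKBmAt_KInvStep (d := 3) hr 0
  set δ' : ℝ := min δ₂ δG with hδ'
  have hδ'pos : 0 < δ' := lt_min hδ₂ hδG
  have hS₂' : ∀ κ u κ' u', BiLoc (S₂ κ u κ' u') u u (Ck * Real.exp (-δ' * l1 (u' - u))) δ' := fun κ u κ' u' x w c b =>
    (hS₂ κ u κ' u' x w c b).trans (mul_le_mul (mul_le_mul_of_nonneg_left (Real.exp_le_exp.mpr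
      (by nlinarith [l1_nonneg (u' - u), min_le_left δ₂ δG])) hCk)
      (Real.exp_le_exp.mpr (by nlinarith [l1_nonneg (x - u), l1_nonneg (w - u), min_le_left δ₂ δG])) (Real.exp_pos _).le
      (mul_nonneg hCk (Real.exp_pos _).le))
  have hlit : W2litInf m r S₂ μ 0 ν z
      = vertex2OfK (coDressKBmAt (toSite r) (m + 1) (KInvStep (d := 3) (m + 1) 0)) (m + 1) S₂ μ 0 ν z := by
    rw [vertex2OfK_eq_sliceSum (N := m + 1) hG hCG hS₂' hCk hδ'pos (min_le_right _ _)]; rfl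
  -- the displayed pair letter is nonnegative at coincident bonds
  have hmB : 0 ≤ mB j i := by
    have h := hBm 0 0 0 0 j i
    rw [sub_self, l1_zero, mul_zero, Real.exp_zero, mul_one] at h
    exact (tsum_nonneg fun p => Finset.sum_nonneg fun g _ => Finset.sum_nonneg fun f _ => abs_nonneg _).trans h
  have hV := mass_blk_vertex2OfK_G₀_le_blockRate m hr hδ₀ hBs hBm μ 0 ν z j i
  rw [← hlit, sub_zero] at hV
  -- the literal block's bound, constant made n-free, rate merged
  have hK₀0 : 0 ≤ K₀ := by
    have h := colH_G₀_road_weight_nonneg m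
    have h1 : (0 : ℝ) < ((((m + 1 : ℕ) : ℝ)) ^ 4)⁻¹ := by positivity
    exact (mul_nonneg_iff_of_pos_left h1).1 h
  have hA0 : 0 ≤ 16 * K₀ ^ 2 * (1 + 16 / (kappa163 4 / 4)) ^ 4 := by positivity
  have hZ := Zl_blockRate_le m hδ₀
  have hρL : ρ ≤ min (kappa163 4 / 4 / 8) (δ₀ / 2) := le_min (min_le_left _ _) ((min_le_right _ _).trans (min_le_left _ _))
  have hρN : ρ ≤ κc := (min_le_right _ _).trans (min_le_right _ _)
  have eL : Real.exp (-(min (kappa163 4 / 4 / 8) (δ₀ / 2)) * l1 z) ≤ Real.exp (-ρ * l1 z) :=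
    Real.exp_le_exp.mpr (by nlinarith [l1_nonneg z, hρL])
  have bL : ∑' q : Site 4 × Site 4, ∑ g, ∑ f, |blk (W2litInf m r S₂ μ 0 ν z) j i q.1 q.2 g f|
      ≤ 16 * K₀ ^ 2 * (1 + 16 / (kappa163 4 / 4)) ^ 4 * (1 + 4 / δ₀) ^ 4 * mB j i * Real.exp (-ρ * l1 z) := by
    have h2 := mul_le_mul_of_nonneg_right (mul_le_mul_of_nonneg_left hZ hA0) hmB
    have e1 : 16 * K₀ ^ 2 * (1 + 16 / (kappa163 4 / 4)) ^ 4 * Zl 4 (δ₀ / ((m + 1 : ℕ) : ℝ) / 2) * ((((m + 1 : ℕ) : ℝ)) ^ 4)⁻¹ * mB j i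
        = 16 * K₀ ^ 2 * (1 + 16 / (kappa163 4 / 4)) ^ 4 * (Zl 4 (δ₀ / ((m + 1 : ℕ) : ℝ) / 2) * ((((m + 1 : ℕ) : ℝ)) ^ 4)⁻¹) * mB j i := by
      ring
    have h1 : 16 * K₀ ^ 2 * (1 + 16 / (kappa163 4 / 4)) ^ 4 * Zl 4 (δ₀ / ((m + 1 : ℕ) : ℝ) / 2) * ((((m + 1 : ℕ) : ℝ)) ^ 4)⁻¹ * mB j i
        ≤ 16 * K₀ ^ 2 * (1 + 16 / (kappa163 4 / 4)) ^ 4 * (1 + 4 / δ₀) ^ 4 * mB j i := by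
      rw [e1]
      exact h2
    exact hV.2.trans (mul_le_mul h1 eL (Real.exp_pos _).le (by positivity))
  -- the co-frame block's bound, rate merged
  have hmC : 0 ≤ mC j i := by
    have h := hCm 0 j i
    rw [l1_zero, mul_zero, Real.exp_zero, mul_one] at h
    exact (tsum_nonneg fun q => Finset.sum_nonneg fun g _ => Finset.sum_nonneg fun f _ => abs_nonneg _).trans h
  have eN : Real.exp (-κc * l1 z) ≤ Real.exp (-ρ * l1 z) := Real.exp_le_exp.mpr (by nlinarith [l1_nonneg z, hρN])
  have bN : ∑' q : Site 4 × Site 4, ∑ g, ∑ f,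
      |blk (embFF (cofPairInf (m + 1) a (colH (coDressKBmAt (toSite r) (m + 1) (KInvStep (d := 3) (m + 1) 0)) (m + 1) μ 0)
        (colH (coDressKBmAt (toSite r) (m + 1) (KInvStep (d := 3) (m + 1) 0)) (m + 1) ν z))) j i q.1 q.2 g f| ≤ mC j i * Real.exp (-ρ * l1 z) :=
    (hCm z j i).trans (mul_le_mul_of_nonneg_left eN hmC)
  -- every block: dominated entrywise by literal + co-frame (`abs_blk_W2NInf_le`), summed
  have hpt : ∀ q : Site 4 × Site 4, ∑ g, ∑ f, |blk (W2NInf m a r S₂ μ 0 ν z) j i q.1 q.2 g f|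
      ≤ (∑ g, ∑ f, |blk (W2litInf m r S₂ μ 0 ν z) j i q.1 q.2 g f|)
        + ∑ g, ∑ f, |blk (embFF (cofPairInf (m + 1) a (colH (coDressKBmAt (toSite r) (m + 1) (KInvStep (d := 3) (m + 1) 0)) (m + 1) μ 0)
            (colH (coDressKBmAt (toSite r) (m + 1) (KInvStep (d := 3) (m + 1) 0)) (m + 1) ν z))) j i q.1 q.2 g f| := fun q => by
    rw [← Finset.sum_add_distrib]
    refine Finset.sum_le_sum fun g _ => ?_
    rw [← Finset.sum_add_distrib]
    exact Finset.sum_le_sum fun f _ => abs_blk_W2NInf_le m a r S₂ μ 0 ν z j i q.1 q.2 g f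
  have h0 : ∀ q : Site 4 × Site 4, 0 ≤ ∑ g, ∑ f, |blk (W2NInf m a r S₂ μ 0 ν z) j i q.1 q.2 g f| := fun q =>
    Finset.sum_nonneg fun g _ => Finset.sum_nonneg fun f _ => abs_nonneg _
  have hsum := hV.1.add (hCs z j i)
  have hs : Summable fun q : Site 4 × Site 4 => ∑ g, ∑ f, |blk (W2NInf m a r S₂ μ 0 ν z) j i q.1 q.2 g f| :=
    Summable.of_nonneg_of_le h0 hpt hsum
  refine ⟨hs, ?_⟩
  calc ∑' q : Site 4 × Site 4, ∑ g, ∑ f, |blk (W2NInf m a r S₂ μ 0 ν z) j i q.1 q.2 g f|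
      ≤ ∑' q : Site 4 × Site 4, ((∑ g, ∑ f, |blk (W2litInf m r S₂ μ 0 ν z) j i q.1 q.2 g f|)
          + ∑ g, ∑ f, |blk (embFF (cofPairInf (m + 1) a (colH (coDressKBmAt (toSite r) (m + 1) (KInvStep (d := 3) (m + 1) 0)) (m + 1) μ 0)
              (colH (coDressKBmAt (toSite r) (m + 1) (KInvStep (d := 3) (m + 1) 0)) (m + 1) ν z))) j i q.1 q.2 g f|) :=
        Summable.tsum_le_tsum hpt hs hsum
    _ = (∑' q : Site 4 × Site 4, ∑ g, ∑ f, |blk (W2litInf m r S₂ μ 0 ν z) j i q.1 q.2 g f|)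
          + ∑' q : Site 4 × Site 4, ∑ g, ∑ f,
              |blk (embFF (cofPairInf (m + 1) a (colH (coDressKBmAt (toSite r) (m + 1) (KInvStep (d := 3) (m + 1) 0)) (m + 1) μ 0)
                (colH (coDressKBmAt (toSite r) (m + 1) (KInvStep (d := 3) (m + 1) 0)) (m + 1) ν z))) j i q.1 q.2 g f| :=
        hV.1.tsum_add (hCs z j i)
    _ ≤ 16 * K₀ ^ 2 * (1 + 16 / (kappa163 4 / 4)) ^ 4 * (1 + 4 / δ₀) ^ 4 * mB j i * Real.exp (-ρ * l1 z) + mC j i * Real.exp (-ρ * l1 z) :=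
        add_le_add bL bN
    _ = _ := by ring

/-! ## §2 The lane letters at the block sizes `Lc^k` from MASS letters -/

section Letters

variable {Lc : ℕ} [NeZero Lc] {a : ℝ} {r : ℕ → Fin (3 + 1) → ℕ} {S : ℕ → Fin 4 → (Fin 4 → ℤ) → MKer 4 (Fib 3)}
  {S₂ : ℕ → Fin 4 → (Fin 4 → ℤ) → Fin 4 → (Fin 4 → ℤ) → MKer 4 (Fib 3)} {μ ν : Fin 4}

/-- [folklore] **THE FIRST-JET BLOCK LETTERS OF `Vroad a r S (Lc^k)`, `k ≥ 1`, FROM (L1-M) + (C1) ON THE SCALES**: from the roots `hr`, (L1-M) at rate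
`σS∕Lc^k` (`≤ mS j k′`, k-free), one rate `0 ≤ σV ≤ κ′∕16`, `σV ≤ σS`, and (C1) at rate `σV∕Lc^k` (`≤ mT`): the blocks of `Vroad a r S (Lc^k) ρ y` have
`(Lc^k)•y`-centred `σV∕Lc^k`-weighted masses, summable and `≤ 4·C_{G₀}·(1+16∕κ′)⁴·(mS j k′ + [tt]·mT)`. -/
theorem jet_letters_mass (hr : ∀ m : ℕ, r (m + 1) ∈ box (3 + 1) (m + 1)) {σS : ℝ} {mS : Bool → Bool → ℝ}
    (hSs : ∀ (k : ℕ), 1 ≤ k → ∀ (κ : Fin 4) (u : Fin 4 → ℤ) (j k' : Bool), Summable fun p : Site 4 × Site 4 =>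
      ∑ g, ∑ f, |blk (S (Lc ^ k) κ u) j k' p.1 p.2 g f| * Real.exp (σS / ((Lc ^ k : ℕ) : ℝ) * (l1 (p.1 - u) + l1 (p.2 - u))))
    (hSm : ∀ (k : ℕ), 1 ≤ k → ∀ (κ : Fin 4) (u : Fin 4 → ℤ) (j k' : Bool), ∑' p : Site 4 × Site 4,
      ∑ g, ∑ f, |blk (S (Lc ^ k) κ u) j k' p.1 p.2 g f| * Real.exp (σS / ((Lc ^ k : ℕ) : ℝ) * (l1 (p.1 - u) + l1 (p.2 - u))) ≤ mS j k')
    {σV : ℝ} (hσV0 : 0 ≤ σV) (hσVκ : σV ≤ kappa163 4 / 4 / 16) (hσVσ : σV ≤ σS) {mT : ℝ}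
    (hTs : ∀ (k : ℕ), 1 ≤ k → ∀ (κ : Fin 4) (u : Fin 4 → ℤ), Summable fun p : Site 4 × Site 4 =>
      ∑ g, ∑ f, |tBw₁ (Lc ^ k) a κ u p.1 p.2 g f| * Real.exp (σV / ((Lc ^ k : ℕ) : ℝ) * (l1 (p.1 - u) + l1 (p.2 - u))))
    (hTm : ∀ (k : ℕ), 1 ≤ k → ∀ (κ : Fin 4) (u : Fin 4 → ℤ), ∑' p : Site 4 × Site 4,
      ∑ g, ∑ f, |tBw₁ (Lc ^ k) a κ u p.1 p.2 g f| * Real.exp (σV / ((Lc ^ k : ℕ) : ℝ) * (l1 (p.1 - u) + l1 (p.2 - u))) ≤ mT) :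
    ∀ (k : ℕ), 1 ≤ k → ∀ (ρ : Fin 4) (y : Site 4) (j k' : Bool),
      (Summable fun p : Site 4 × Site 4 => ∑ g, ∑ f, |blk (Vroad a r S (Lc ^ k) ρ y) j k' p.1 p.2 g f|
        * Real.exp (σV / ((Lc ^ k : ℕ) : ℝ) * (l1 (p.1 - ((Lc ^ k : ℕ) : ℤ) • y) + l1 (p.2 - ((Lc ^ k : ℕ) : ℤ) • y)))) ∧
      ∑' p : Site 4 × Site 4, ∑ g, ∑ f, |blk (Vroad a r S (Lc ^ k) ρ y) j k' p.1 p.2 g f|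
        * Real.exp (σV / ((Lc ^ k : ℕ) : ℝ) * (l1 (p.1 - ((Lc ^ k : ℕ) : ℤ) • y) + l1 (p.2 - ((Lc ^ k : ℕ) : ℤ) • y)))
      ≤ 4 * ((MG163 4 * periodConst (kappa163 4) 3) * (1 + 8 * (1 + Real.exp (kappa163 4 / 4))) * Real.exp (kappa163 4 / 4))
            * (1 + 16 / (kappa163 4 / 4)) ^ 4 * (mS j k' + (bif (j && k') then mT else 0)) := by
  intro k hk ρ y j k'
  have hn0 : (0 : ℝ) < ((Lc ^ k : ℕ) : ℝ) := by
    exact_mod_cast Nat.pos_of_ne_zero (pow_ne_zero k (NeZero.ne Lc))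
  have hrk : r (Lc ^ k) ∈ box (3 + 1) (Lc ^ k) := by
    have h := hr (Lc ^ k - 1)
    rwa [Nat.sub_add_cancel (Nat.one_le_pow _ _ (Nat.pos_of_ne_zero (NeZero.ne Lc)))] at h
  -- the literal letters at the smaller rate `σV∕n ≤ σS∕n`
  have hrate : σV / ((Lc ^ k : ℕ) : ℝ) ≤ σS / ((Lc ^ k : ℕ) : ℝ) := div_le_div_of_nonneg_right hσVσ hn0.le
  have hlit : ∀ (κ : Fin 4) (u : Fin 4 → ℤ) (j k' : Bool),
      (Summable fun p : Site 4 × Site 4 => ∑ g, ∑ f, |blk (S (Lc ^ k) κ u) j k' p.1 p.2 g f|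
        * Real.exp (σV / ((Lc ^ k : ℕ) : ℝ) * (l1 (p.1 - u) + l1 (p.2 - u)))) ∧
      ∑' p : Site 4 × Site 4, ∑ g, ∑ f, |blk (S (Lc ^ k) κ u) j k' p.1 p.2 g f|
        * Real.exp (σV / ((Lc ^ k : ℕ) : ℝ) * (l1 (p.1 - u) + l1 (p.2 - u))) ≤ mS j k' := fun κ u j k' =>
    mass_rate_mono hrate (hSs k hk κ u j k') (hSm k hk κ u j k')
  rw [Vroad_of_neZero]
  exact road_jet_mass_at (Lc ^ k) hrk (S := S (Lc ^ k)) (mS := mS) (rate_window hσV0 hσVκ (Lc ^ k)).1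
    (rate_window hσV0 hσVκ (Lc ^ k)).2 (fun κ u j k' => (hlit κ u j k').1) (fun κ u j k' => (hlit κ u j k').2) (hTs k hk) (hTm k hk) ρ y j k'

/-- [folklore] **THE SECOND-TABLE BLOCK LETTERS OF `Wroad a r S₂ (Lc^k) μ 0 ν z`, `k ≥ 1`, FROM (L2-M) + (C2) ON THE SCALES**: from the roots `hr`, the
per-scale pair socket `hS₂` (ANY constants — only the slice-sum identity uses it), (L2-M) plain block masses `≤ mB j i·e^{−(δ₀∕Lc^k)|u′−u|₁}` (k-free, `0 < δ₀`)
and (C2): summable plain masses `≤ (16·C_{G₀}²·(1+16∕κ′)⁴·(1+4∕δ₀)⁴·mB j i + mC j i)·e^{−min (κ′∕8) (min (δ₀∕2) κc)·|z|₁}`. -/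
theorem table_letters_mass (hL : 2 ≤ Lc) (hr : ∀ m : ℕ, r (m + 1) ∈ box (3 + 1) (m + 1))
    {Ck δ₂ : ℕ → ℝ} (hS₂ : ∀ n : ℕ, 2 ≤ n → ∀ κ u κ' u', BiLoc (S₂ n κ u κ' u') u u (Ck n * Real.exp (-δ₂ n * l1 (u' - u))) (δ₂ n))
    (hCk : ∀ n, 0 ≤ Ck n) (hδ₂ : ∀ n, 0 < δ₂ n)
    {δ₀ : ℝ} (hδ₀ : 0 < δ₀) {mB : Bool → Bool → ℝ}
    (hBs : ∀ (k : ℕ), 1 ≤ k → ∀ (κ : Fin 4) (u : Fin 4 → ℤ) (κ' : Fin 4) (u' : Fin 4 → ℤ) (j i : Bool),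
      Summable fun p : Site 4 × Site 4 => ∑ g, ∑ f, |blk (S₂ (Lc ^ k) κ u κ' u') j i p.1 p.2 g f|)
    (hBm : ∀ (k : ℕ), 1 ≤ k → ∀ (κ : Fin 4) (u : Fin 4 → ℤ) (κ' : Fin 4) (u' : Fin 4 → ℤ) (j i : Bool),
      ∑' p : Site 4 × Site 4, ∑ g, ∑ f, |blk (S₂ (Lc ^ k) κ u κ' u') j i p.1 p.2 g f|
        ≤ mB j i * Real.exp (-(δ₀ / ((Lc ^ k : ℕ) : ℝ)) * l1 (u' - u)))
    {mC : Bool → Bool → ℝ} {κc : ℝ}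
    (hCs : ∀ (k : ℕ), 1 ≤ k → ∀ (z : Site 4) (j i : Bool), Summable fun q : Site 4 × Site 4 => ∑ g, ∑ f,
      |blk (embFF (cofPairInf (Lc ^ k) a (colH (coDressKBmAt (toSite (r (Lc ^ k))) (Lc ^ k) (KInvStep (d := 3) (Lc ^ k) 0)) (Lc ^ k) μ 0)
        (colH (coDressKBmAt (toSite (r (Lc ^ k))) (Lc ^ k) (KInvStep (d := 3) (Lc ^ k) 0)) (Lc ^ k) ν z))) j i q.1 q.2 g f|)
    (hCm : ∀ (k : ℕ), 1 ≤ k → ∀ (z : Site 4) (j i : Bool), ∑' q : Site 4 × Site 4, ∑ g, ∑ f,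
      |blk (embFF (cofPairInf (Lc ^ k) a (colH (coDressKBmAt (toSite (r (Lc ^ k))) (Lc ^ k) (KInvStep (d := 3) (Lc ^ k) 0)) (Lc ^ k) μ 0)
        (colH (coDressKBmAt (toSite (r (Lc ^ k))) (Lc ^ k) (KInvStep (d := 3) (Lc ^ k) 0)) (Lc ^ k) ν z))) j i q.1 q.2 g f|
        ≤ mC j i * Real.exp (-κc * l1 z)) :
    ∀ (k : ℕ), 1 ≤ k → ∀ (z : Site 4) (j i : Bool),
      (Summable fun q : Site 4 × Site 4 => ∑ g, ∑ f, |blk (Wroad a r S₂ (Lc ^ k) μ 0 ν z) j i q.1 q.2 g f|) ∧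
      ∑' q : Site 4 × Site 4, ∑ g, ∑ f, |blk (Wroad a r S₂ (Lc ^ k) μ 0 ν z) j i q.1 q.2 g f|
      ≤ (16 * ((MG163 4 * periodConst (kappa163 4) 3) * (1 + 8 * (1 + Real.exp (kappa163 4 / 4))) * Real.exp (kappa163 4 / 4)) ^ 2
            * (1 + 16 / (kappa163 4 / 4)) ^ 4 * (1 + 4 / δ₀) ^ 4 * mB j i + mC j i)
        * Real.exp (-(min (kappa163 4 / 4 / 8) (min (δ₀ / 2) κc)) * l1 z) := by
  intro k hk z j i
  have hn2 : 2 ≤ Lc ^ k := hL.trans (Nat.le_self_pow (Nat.one_le_iff_ne_zero.mp hk) Lc)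
  have hrk : r (Lc ^ k) ∈ box (3 + 1) (Lc ^ k) := by
    have h := hr (Lc ^ k - 1)
    rwa [Nat.sub_add_cancel (Nat.one_le_pow _ _ (Nat.pos_of_ne_zero (NeZero.ne Lc)))] at h
  rw [Wroad_of_neZero]
  exact road_table_mass_at_of_mass (Lc ^ k) hrk (hS₂ (Lc ^ k) hn2) (hCk (Lc ^ k)) (hδ₂ (Lc ^ k)) hδ₀ (hBs k hk) (hBm k hk)
    (hCs k hk) (hCm k hk) z j i

end Letters

/-! ## §3 PART 13∕14∕15's sandwich ∕ block rows at the road's jets on the subsequence, from MASS letters -/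

section Rows

variable {Lc : ℕ} [NeZero Lc] {a : ℝ} (ha : 0 < a) {r : ℕ → Fin (3 + 1) → ℕ} {S : ℕ → Fin 4 → (Fin 4 → ℤ) → MKer 4 (Fib 3)}
  {S₂ : ℕ → Fin 4 → (Fin 4 → ℤ) → Fin 4 → (Fin 4 → ℤ) → MKer 4 (Fib 3)} {μ ν : Fin 4}
  {Ck δ₂ : ℕ → ℝ} {σS σV mT δ₀ κc : ℝ} {mS mB mC : Bool → Bool → ℝ}
include ha

/-- [folklore] **«ROAD ROWS FROM MASS LETTERS» — THE BLOCK LANE**: PART 13∕14∕15's (i) `hMR` and (ii) READING (b) `hRu` (`Ru := 0`) for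
`RkBlk a (Vroad a r S) (Wroad a r S₂)` on `n = Lc^k`, `k ≥ 1`, from `2 ≤ Lc`, [B5] BY NAME, `hr`, (L1-M) `hSs hSm`, `0 < σV ≤ κ′∕16`, `σV ≤ σS`, (C1) `hTs hTm`,
the per-scale pair socket `hS₂ hCk hδ₂`, `0 < δ₀`, (L2-M) `hBs hBm`, `0 < κc`, (C2) `hCs′ hCm`; `CU′ := CUblk kG K c σV mV κV mW`,
`mV j k := 4·C_{G₀}·(1+16∕κ′)⁴·(mS j k + [tt]·mT)`, `κV := min (κ′∕8) (min (δ₀∕2) κc)`, `mW j i := 16·C_{G₀}²·(1+16∕κ′)⁴·(1+4∕δ₀)⁴·mB j i + mC j i`. -/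
theorem road_blk_rows_mass (hL : 2 ≤ Lc) (h12 : B5.Prop12Printed (fam nOf hn1 MOf a ha)) (h126 : B5.Kernel126_127Printed (kfam nOf MOf))
    (hr : ∀ m : ℕ, r (m + 1) ∈ box (3 + 1) (m + 1))
    (hSs : ∀ (k : ℕ), 1 ≤ k → ∀ (κ : Fin 4) (u : Fin 4 → ℤ) (j k' : Bool), Summable fun p : Site 4 × Site 4 =>
      ∑ g, ∑ f, |blk (S (Lc ^ k) κ u) j k' p.1 p.2 g f| * Real.exp (σS / ((Lc ^ k : ℕ) : ℝ) * (l1 (p.1 - u) + l1 (p.2 - u))))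
    (hSm : ∀ (k : ℕ), 1 ≤ k → ∀ (κ : Fin 4) (u : Fin 4 → ℤ) (j k' : Bool), ∑' p : Site 4 × Site 4,
      ∑ g, ∑ f, |blk (S (Lc ^ k) κ u) j k' p.1 p.2 g f| * Real.exp (σS / ((Lc ^ k : ℕ) : ℝ) * (l1 (p.1 - u) + l1 (p.2 - u))) ≤ mS j k')
    (hσV : 0 < σV) (hσVκ : σV ≤ kappa163 4 / 4 / 16) (hσVσ : σV ≤ σS)
    (hTs : ∀ (k : ℕ), 1 ≤ k → ∀ (κ : Fin 4) (u : Fin 4 → ℤ), Summable fun p : Site 4 × Site 4 =>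
      ∑ g, ∑ f, |tBw₁ (Lc ^ k) a κ u p.1 p.2 g f| * Real.exp (σV / ((Lc ^ k : ℕ) : ℝ) * (l1 (p.1 - u) + l1 (p.2 - u))))
    (hTm : ∀ (k : ℕ), 1 ≤ k → ∀ (κ : Fin 4) (u : Fin 4 → ℤ), ∑' p : Site 4 × Site 4,
      ∑ g, ∑ f, |tBw₁ (Lc ^ k) a κ u p.1 p.2 g f| * Real.exp (σV / ((Lc ^ k : ℕ) : ℝ) * (l1 (p.1 - u) + l1 (p.2 - u))) ≤ mT)
    (hS₂ : ∀ n : ℕ, 2 ≤ n → ∀ κ u κ' u', BiLoc (S₂ n κ u κ' u') u u (Ck n * Real.exp (-δ₂ n * l1 (u' - u))) (δ₂ n))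
    (hCk : ∀ n, 0 ≤ Ck n) (hδ₂ : ∀ n, 0 < δ₂ n) (hδ₀ : 0 < δ₀)
    (hBs : ∀ (k : ℕ), 1 ≤ k → ∀ (κ : Fin 4) (u : Fin 4 → ℤ) (κ' : Fin 4) (u' : Fin 4 → ℤ) (j i : Bool),
      Summable fun p : Site 4 × Site 4 => ∑ g, ∑ f, |blk (S₂ (Lc ^ k) κ u κ' u') j i p.1 p.2 g f|)
    (hBm : ∀ (k : ℕ), 1 ≤ k → ∀ (κ : Fin 4) (u : Fin 4 → ℤ) (κ' : Fin 4) (u' : Fin 4 → ℤ) (j i : Bool),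
      ∑' p : Site 4 × Site 4, ∑ g, ∑ f, |blk (S₂ (Lc ^ k) κ u κ' u') j i p.1 p.2 g f|
        ≤ mB j i * Real.exp (-(δ₀ / ((Lc ^ k : ℕ) : ℝ)) * l1 (u' - u)))
    (hκc : 0 < κc)
    (hCs' : ∀ (k : ℕ), 1 ≤ k → ∀ (z : Site 4) (j i : Bool), Summable fun q : Site 4 × Site 4 => ∑ g, ∑ f,
      |blk (embFF (cofPairInf (Lc ^ k) a (colH (coDressKBmAt (toSite (r (Lc ^ k))) (Lc ^ k) (KInvStep (d := 3) (Lc ^ k) 0)) (Lc ^ k) μ 0)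
        (colH (coDressKBmAt (toSite (r (Lc ^ k))) (Lc ^ k) (KInvStep (d := 3) (Lc ^ k) 0)) (Lc ^ k) ν z))) j i q.1 q.2 g f|)
    (hCm : ∀ (k : ℕ), 1 ≤ k → ∀ (z : Site 4) (j i : Bool), ∑' q : Site 4 × Site 4, ∑ g, ∑ f,
      |blk (embFF (cofPairInf (Lc ^ k) a (colH (coDressKBmAt (toSite (r (Lc ^ k))) (Lc ^ k) (KInvStep (d := 3) (Lc ^ k) 0)) (Lc ^ k) μ 0)
        (colH (coDressKBmAt (toSite (r (Lc ^ k))) (Lc ^ k) (KInvStep (d := 3) (Lc ^ k) 0)) (Lc ^ k) ν z))) j i q.1 q.2 g f|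
        ≤ mC j i * Real.exp (-κc * l1 z)) :
    ∃ kG K c : ℝ, 0 < c ∧ 0 ≤ kG ∧ 0 ≤ K ∧
      (∀ (u : (Bool × Bool) ⊕ (Bool × Bool × Bool × Bool)) (k : ℕ), 1 ≤ k → AbsMoment₂ (RkBlk a (Vroad a r S) (Wroad a r S₂) u (Lc ^ k) μ ν)) ∧
      (∀ (u : (Bool × Bool) ⊕ (Bool × Bool × Bool × Bool)) (k : ℕ), 1 ≤ k →
        |B12Beta.secondMoment (RkBlk a (Vroad a r S) (Wroad a r S₂) u (Lc ^ k)) μ ν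
          - (fun (_ : (Bool × Bool) ⊕ (Bool × Bool × Bool × Bool)) (_ : ℕ) => (0 : ℝ)) u (Lc ^ k)|
          ≤ CUblk kG K c σV (fun j k' => 4 * ((MG163 4 * periodConst (kappa163 4) 3) * (1 + 8 * (1 + Real.exp (kappa163 4 / 4))) * Real.exp (kappa163 4 / 4))
              * (1 + 16 / (kappa163 4 / 4)) ^ 4 * (mS j k' + (bif (j && k') then mT else 0)))
            (min (kappa163 4 / 4 / 8) (min (δ₀ / 2) κc))
            (fun j i => 16 * ((MG163 4 * periodConst (kappa163 4) 3) * (1 + 8 * (1 + Real.exp (kappa163 4 / 4))) * Real.exp (kappa163 4 / 4)) ^ 2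
              * (1 + 16 / (kappa163 4 / 4)) ^ 4 * (1 + 4 / δ₀) ^ 4 * mB j i + mC j i) u) := by
  have hV := jet_letters_mass (Lc := Lc) hr hSs hSm hσV.le hσVκ hσVσ hTs hTm
  have hW := table_letters_mass (Lc := Lc) (μ := μ) (ν := ν) hL hr hS₂ hCk hδ₂ hδ₀ hBs hBm hCs' hCm
  have key := exists_END_rows_RkBlk_pow (Lc := Lc) (𝒱 := Vroad a r S) (𝒲 := Wroad a r S₂) (μ := μ) (ν := ν) ha h12 h126 hσV
    (fun k hk ρ y j k' => (hV k hk ρ y j k').1) (fun k hk ρ y j k' => (hV k hk ρ y j k').2) (road_tableRate_pos hδ₀ hκc)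
    (fun k hk z j i => (hW k hk z j i).1) (fun k hk z j i => (hW k hk z j i).2)
  obtain ⟨kG, K, c, hc, hkG, hK, h1, h2, -⟩ := key
  exact ⟨kG, K, c, hc, hkG, hK, h1, h2⟩

/-- [folklore] **«ROAD ROWS FROM MASS LETTERS» — THE SANDWICH LANE** (the ff instances of the same letters): PART 13∕14∕15's (i)(ii) rows for
`RkSand a (Vroad a r S) (Wroad a r S₂)` at every `Lc^k`, `k ≥ 1`,
`CU′ := CUsand kG K c σV (4·C_{G₀}·(1+16∕κ′)⁴·(mS tt tt + mT)) κV (16·C_{G₀}²·(1+16∕κ′)⁴·(1+4∕δ₀)⁴·mB tt tt + mC tt tt)`. -/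
theorem road_sand_rows_mass (hL : 2 ≤ Lc) (h12 : B5.Prop12Printed (fam nOf hn1 MOf a ha)) (h126 : B5.Kernel126_127Printed (kfam nOf MOf))
    (hr : ∀ m : ℕ, r (m + 1) ∈ box (3 + 1) (m + 1))
    (hSs : ∀ (k : ℕ), 1 ≤ k → ∀ (κ : Fin 4) (u : Fin 4 → ℤ) (j k' : Bool), Summable fun p : Site 4 × Site 4 =>
      ∑ g, ∑ f, |blk (S (Lc ^ k) κ u) j k' p.1 p.2 g f| * Real.exp (σS / ((Lc ^ k : ℕ) : ℝ) * (l1 (p.1 - u) + l1 (p.2 - u))))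
    (hSm : ∀ (k : ℕ), 1 ≤ k → ∀ (κ : Fin 4) (u : Fin 4 → ℤ) (j k' : Bool), ∑' p : Site 4 × Site 4,
      ∑ g, ∑ f, |blk (S (Lc ^ k) κ u) j k' p.1 p.2 g f| * Real.exp (σS / ((Lc ^ k : ℕ) : ℝ) * (l1 (p.1 - u) + l1 (p.2 - u))) ≤ mS j k')
    (hσV : 0 < σV) (hσVκ : σV ≤ kappa163 4 / 4 / 16) (hσVσ : σV ≤ σS)
    (hTs : ∀ (k : ℕ), 1 ≤ k → ∀ (κ : Fin 4) (u : Fin 4 → ℤ), Summable fun p : Site 4 × Site 4 =>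
      ∑ g, ∑ f, |tBw₁ (Lc ^ k) a κ u p.1 p.2 g f| * Real.exp (σV / ((Lc ^ k : ℕ) : ℝ) * (l1 (p.1 - u) + l1 (p.2 - u))))
    (hTm : ∀ (k : ℕ), 1 ≤ k → ∀ (κ : Fin 4) (u : Fin 4 → ℤ), ∑' p : Site 4 × Site 4,
      ∑ g, ∑ f, |tBw₁ (Lc ^ k) a κ u p.1 p.2 g f| * Real.exp (σV / ((Lc ^ k : ℕ) : ℝ) * (l1 (p.1 - u) + l1 (p.2 - u))) ≤ mT)
    (hS₂ : ∀ n : ℕ, 2 ≤ n → ∀ κ u κ' u', BiLoc (S₂ n κ u κ' u') u u (Ck n * Real.exp (-δ₂ n * l1 (u' - u))) (δ₂ n))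
    (hCk : ∀ n, 0 ≤ Ck n) (hδ₂ : ∀ n, 0 < δ₂ n) (hδ₀ : 0 < δ₀)
    (hBs : ∀ (k : ℕ), 1 ≤ k → ∀ (κ : Fin 4) (u : Fin 4 → ℤ) (κ' : Fin 4) (u' : Fin 4 → ℤ) (j i : Bool),
      Summable fun p : Site 4 × Site 4 => ∑ g, ∑ f, |blk (S₂ (Lc ^ k) κ u κ' u') j i p.1 p.2 g f|)
    (hBm : ∀ (k : ℕ), 1 ≤ k → ∀ (κ : Fin 4) (u : Fin 4 → ℤ) (κ' : Fin 4) (u' : Fin 4 → ℤ) (j i : Bool),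
      ∑' p : Site 4 × Site 4, ∑ g, ∑ f, |blk (S₂ (Lc ^ k) κ u κ' u') j i p.1 p.2 g f|
        ≤ mB j i * Real.exp (-(δ₀ / ((Lc ^ k : ℕ) : ℝ)) * l1 (u' - u)))
    (hκc : 0 < κc)
    (hCs' : ∀ (k : ℕ), 1 ≤ k → ∀ (z : Site 4) (j i : Bool), Summable fun q : Site 4 × Site 4 => ∑ g, ∑ f,
      |blk (embFF (cofPairInf (Lc ^ k) a (colH (coDressKBmAt (toSite (r (Lc ^ k))) (Lc ^ k) (KInvStep (d := 3) (Lc ^ k) 0)) (Lc ^ k) μ 0)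
        (colH (coDressKBmAt (toSite (r (Lc ^ k))) (Lc ^ k) (KInvStep (d := 3) (Lc ^ k) 0)) (Lc ^ k) ν z))) j i q.1 q.2 g f|)
    (hCm : ∀ (k : ℕ), 1 ≤ k → ∀ (z : Site 4) (j i : Bool), ∑' q : Site 4 × Site 4, ∑ g, ∑ f,
      |blk (embFF (cofPairInf (Lc ^ k) a (colH (coDressKBmAt (toSite (r (Lc ^ k))) (Lc ^ k) (KInvStep (d := 3) (Lc ^ k) 0)) (Lc ^ k) μ 0)
        (colH (coDressKBmAt (toSite (r (Lc ^ k))) (Lc ^ k) (KInvStep (d := 3) (Lc ^ k) 0)) (Lc ^ k) ν z))) j i q.1 q.2 g f|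
        ≤ mC j i * Real.exp (-κc * l1 z)) :
    ∃ kG K c : ℝ, 0 < c ∧ 0 ≤ kG ∧ 0 ≤ K ∧
      (∀ (u : Unit ⊕ (Bool × Bool)) (k : ℕ), 1 ≤ k → AbsMoment₂ (RkSand a (Vroad a r S) (Wroad a r S₂) u (Lc ^ k) μ ν)) ∧
      (∀ (u : Unit ⊕ (Bool × Bool)) (k : ℕ), 1 ≤ k →
        |B12Beta.secondMoment (RkSand a (Vroad a r S) (Wroad a r S₂) u (Lc ^ k)) μ ν - (fun (_ : Unit ⊕ (Bool × Bool)) (_ : ℕ) => (0 : ℝ)) u (Lc ^ k)|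
          ≤ CUsand kG K c σV (4 * ((MG163 4 * periodConst (kappa163 4) 3) * (1 + 8 * (1 + Real.exp (kappa163 4 / 4))) * Real.exp (kappa163 4 / 4))
              * (1 + 16 / (kappa163 4 / 4)) ^ 4 * (mS true true + mT))
            (min (kappa163 4 / 4 / 8) (min (δ₀ / 2) κc))
            (16 * ((MG163 4 * periodConst (kappa163 4) 3) * (1 + 8 * (1 + Real.exp (kappa163 4 / 4))) * Real.exp (kappa163 4 / 4)) ^ 2
              * (1 + 16 / (kappa163 4 / 4)) ^ 4 * (1 + 4 / δ₀) ^ 4 * mB true true + mC true true) u) := by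
  have hV := jet_letters_mass (Lc := Lc) hr hSs hSm hσV.le hσVκ hσVσ hTs hTm
  have hW := table_letters_mass (Lc := Lc) (μ := μ) (ν := ν) hL hr hS₂ hCk hδ₂ hδ₀ hBs hBm hCs' hCm
  have key := exists_END_rows_RkSand_pow (Lc := Lc) (𝒱 := Vroad a r S) (𝒲 := Wroad a r S₂) (μ := μ) (ν := ν) ha h12 h126 hσV
    (fun k hk ρ y => (hV k hk ρ y true true).1) (fun k hk ρ y => (hV k hk ρ y true true).2)
    (road_tableRate_pos hδ₀ hκc) (fun k hk z => (hW k hk z true true).1) (fun k hk z => (hW k hk z true true).2)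
  obtain ⟨kG, K, c, hc, hkG, hK, h1, h2, -⟩ := key
  exact ⟨kG, K, c, hc, hkG, hK, h1, h2⟩

end Rows

end Summit.QuantumFields.BalabanUV.Beta.D1BFx.PackedRoadRowsMass

end
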